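import Summits.BirchSwinnertonDyer.BirchSwinnertonDyer.Theorems.PrintCFramTCubeGlobalDefect
import HarnessLib

/-!
# Route PrintCFram, regime T: the `3`-torsion layer of the global defect is EXACTLY `ℤ/3` —
# over `K = ℚ(√−3)` a point of order `3` on `y² = x³ + k` has `x = 0` unless `−4k` is a rational cube
# (cell `bsd-print-cfram`, seat p4 g3; supports stmt-BirchSwinnertonDyer-20699)

HONEST FRAMING (cell `bsd-print-cfram`, run/shared/lean/pub/bsd-print-cfram/, D-0131 (2) print
tier; verbatim in every file of the seat): the cell works the partition leaf
`CornerF ∧ p ramified in the CM field K` (LADDER-BSD row K7r = B13; W-ALL row 12r) in PARTITION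
currency — a leaf or a cell counts only when its theorem is in the kernel BY NAME. Nothing is
closed here. Sequel to `PrintCFramTCubeGlobalDefect.lean` (p558062: over the frame field `K = ℚ(θ)`,
`θ² = −3`, `W(K)[3] ≠ 0` on both members of a `j = 0` pair iff the class is of cube-sum type). THIS
FILE pins the `3`-torsion LAYER of ty3's global defect `d₀ = #W(K)[3^∞]`: a point of order `3` on
`y² = x³ + k` over `K` has abscissa `x = 0` or `x³ = −4k` (Silverman Ex. 3.7); and **`x³ = r ∈ ℚ` has NO
solution in the quadratic field `K` unless `r` is a rational cube** (`(a + bθ)³ ∈ ℚ` forces `b = 0` or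
`a = ±b`, and then `r = a³` or `r = (−2a)³`) — so for `−4k ∉ ℚ³` every `K`-rational point of order `3`
is `(0, ±√k)`: **`W(K)[3] ⊂ {O, (0, √k), (0, −√k)}`, i.e. `#W(K)[3] ≤ 3`**, with equality exactly on
T_cube (p558062). On the T_cube classes of the leaf `−4k ∈ ℚ³` never happens (TOGETHER WITH
`k ∈ ℚ² ∪ −3ℚ²` it forces `k ∈ {16, −432}`, the rank-`0` class 27a; off T_cube `4k` may well be a cube,
e.g. `k = 2` = 1728a, but there `W(K)[3] = 0` by p558062 with no cube hypothesis), so the `3`-layer of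
`d₀` is `ℤ/3` on both members of every T_cube frame and trivial elsewhere; «no `K`-point of order `9`» (ty3 PART H: `d₀ = 3`, not `9`, on
178/178) remains a per-class certificate. Theorems only; no named fact. beyond-print: NO.

References: `Theorems/PrintCFramTCubeGlobalDefect.lean`; `X12/JZeroThreeTorsionCriterion.lean`
(`mordellCurve_three_torsion_x`); [cite: SilvermanAEC2009, Exercise 3.7]; [cite: Marcus1977, Ch. 2 (quadratic fields)].
-/

set_option linter.dupNamespace false
set_option autoImplicit false

noncomputable section

open scoped Classical
open WeierstrassCurve Literature.NumberTheory.EllipticCurves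
  Literature.NumberTheory.EllipticCurves.Rank1Residual
  Summit.BirchSwinnertonDyer.Rank1Residual Summit.BirchSwinnertonDyer.Rank1Residual.X12

namespace Summit.BirchSwinnertonDyer.BirchSwinnertonDyer.Theorems.PrintCFram.GlobalDefect

variable {F : Type*} [Field F] [CharZero F]

/-- **No new cube roots in `ℚ(√−3)`.** If every element of `F` is `a + bθ` (`a, b ∈ ℚ`, `θ² = −3`)
and `x ∈ F` satisfies `x³ = r` with `r ∈ ℚ`, then `r` is a rational cube: expanding
`(a + bθ)³ = (a³ − 9ab²) + 3b(a² − b²)θ` gives `b = 0` (so `r = a³`) or `a = ±b` (so `r = (−2a)³`).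
[cite: Marcus1977, Ch. 2 (quadratic fields)] -/
theorem exists_rat_cube_of_cube_eq_ratCast {θ : F} (hθ : θ ^ 2 = -3)
    (hF : ∀ z : F, ∃ a b : ℚ, z = a + b * θ) {x : F} {r : ℚ} (hx : x ^ 3 = (r : F)) :
    ∃ c : ℚ, c ^ 3 = r := by
  obtain ⟨a, b, rfl⟩ := hF x
  have hexp : (r : F) = ((a ^ 3 - 9 * a * b ^ 2 : ℚ) : F) + ((3 * b * (a ^ 2 - b ^ 2) : ℚ) : F) * θ := by
    rw [← hx]; push_cast
    linear_combination (3 * (a : F) * (b : F) ^ 2 + (b : F) ^ 3 * θ) * hθ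
  by_cases hb3 : 3 * b * (a ^ 2 - b ^ 2) = 0
  · have hr' : ((r : ℚ) : F) = ((a ^ 3 - 9 * a * b ^ 2 : ℚ) : F) := by
      rw [hexp, hb3]; push_cast; ring
    have hr : r = a ^ 3 - 9 * a * b ^ 2 := Rat.cast_injective hr'
    rcases mul_eq_zero.mp hb3 with hb | hab
    · rcases mul_eq_zero.mp hb with h3 | hb
      · norm_num at h3
      · exact ⟨a, by rw [hr, hb]; ring⟩
    · have hab' : (a - b) * (a + b) = 0 := by linear_combination hab
      rcases mul_eq_zero.mp hab' with h | h
      · have : a = b := by linarith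
        exact ⟨-2 * a, by rw [hr, ← this]; ring⟩
      · have : b = -a := by linarith
        exact ⟨-2 * a, by rw [hr, this]; ring⟩
  · exfalso
    apply not_exists_ratCast_eq_of_sq_eq_neg_three hθ
    refine ⟨(r - (a ^ 3 - 9 * a * b ^ 2)) / (3 * b * (a ^ 2 - b ^ 2)), ?_⟩
    have hne : ((3 * b * (a ^ 2 - b ^ 2) : ℚ) : F) ≠ 0 := by exact_mod_cast hb3
    push_cast at hexp hne ⊢
    rw [div_eq_iff hne]
    linear_combination hexp

/-- **Over `ℚ(√−3)`, a point of order `3` on `y² = x³ + k` has `x = 0`** when `−4k` is not a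
rational cube (`k ∈ ℚ`, `k ≠ 0`): the other abscissae of `3`-torsion points satisfy `x³ = −4k`
(`JZeroThree.mordellCurve_three_torsion_x`), impossible in the quadratic field. Hence
`E_k(K)[3] ⊂ {O, (0, ±√k)}`. [cite: SilvermanAEC2009, Exercise 3.7] -/
theorem three_torsion_x_eq_zero {θ : F} (hθ : θ ^ 2 = -3)
    (hF : ∀ z : F, ∃ a b : ℚ, z = a + b * θ) {k : ℚ} (hcube : ¬ ∃ c : ℚ, c ^ 3 = -4 * k)
    {x y : F} (h : (mordellCurve (k : F)).toAffine.Nonsingular x y)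
    (h3 : (3 : ℕ) • (Affine.Point.some x y h : (mordellCurve (k : F)).toAffine.Point) = 0) :
    x = 0 ∧ y ^ 2 = (k : F) := by
  rcases JZeroThree.mordellCurve_three_torsion_x h h3 with hx | ⟨hx, -⟩
  · exact hx
  · exfalso
    apply hcube
    have hx' : x ^ 3 = ((-4 * k : ℚ) : F) := by rw [hx]; push_cast; ring
    exact exists_rat_cube_of_cube_eq_ratCast hθ hF hx'

/-- **At most two points of order `3`**: two `K`-rational points of order `3` on `y² = x³ + k`
(`−4k ∉ ℚ³`) are equal or opposite — both are `(0, ±√k)`. So `#E_k(K)[3] ≤ 3` (`= 3` exactly on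
T_cube, by `exists_three_torsion_iff_tCube`). [cite: SilvermanAEC2009, Exercise 3.7] -/
theorem three_torsion_eq_or_eq_neg {θ : F} (hθ : θ ^ 2 = -3)
    (hF : ∀ z : F, ∃ a b : ℚ, z = a + b * θ) {k : ℚ} (hcube : ¬ ∃ c : ℚ, c ^ 3 = -4 * k)
    {P Q : (mordellCurve (k : F)).toAffine.Point} (hP : (3 : ℕ) • P = 0) (hQ : (3 : ℕ) • Q = 0)
    (hP0 : P ≠ 0) (hQ0 : Q ≠ 0) : P = Q ∨ P = -Q := by
  rcases P with _ | ⟨x₁, y₁, h₁⟩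
  · exact (hP0 rfl).elim
  rcases Q with _ | ⟨x₂, y₂, h₂⟩
  · exact (hQ0 rfl).elim
  obtain ⟨hx₁, hy₁⟩ := three_torsion_x_eq_zero hθ hF hcube h₁ hP
  obtain ⟨hx₂, hy₂⟩ := three_torsion_x_eq_zero hθ hF hcube h₂ hQ
  have hyy : (y₁ - y₂) * (y₁ + y₂) = 0 := by linear_combination hy₁ - hy₂
  rcases mul_eq_zero.mp hyy with hy | hy
  · left
    have : y₁ = y₂ := by linear_combination hy
    subst hx₁ hx₂ this
    rfl
  · right
    have hy' : y₁ = -y₂ := by linear_combination hy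
    rw [Affine.Point.neg_some]
    subst hx₁ hx₂
    congr 1
    rw [hy', Affine.negY, mordellCurve_a₁, mordellCurve_a₃]
    ring

/-- Sign bookkeeping for the cube hypothesis: `−4k ∈ ℚ³ ⟺ 4k ∈ ℚ³` (`−1` is a cube). On T_cube
classes of the leaf (`k ∈ ℚ² ∪ −3ℚ²`, sixth-power-free, `k ∉ {16, −432}`) `4k ∉ ℚ³`; it is refuted per
class from one prime `p` with `3 ∤ v_p(4k)` (`PrintCFramTCubeGlobalDefectCard.lean`). [folklore] -/
theorem exists_cube_neg_iff (k : ℚ) : (∃ c : ℚ, c ^ 3 = -4 * k) ↔ ∃ c : ℚ, c ^ 3 = 4 * k := by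
  constructor <;> rintro ⟨c, hc⟩ <;> exact ⟨-c, by linear_combination -hc⟩

section Frame

variable {K : Type} [Field K] [NumberField K]

/-- **The `3`-layer of `d₀` on a `3`-frame, class-wide.** `[K:ℚ] = 2`, `d_K = −3`, `W` any model over
`ℚ` of `y² = x³ + k` (`C • W = E_k`), `4k ∉ ℚ³`. Then any two non-zero points of `W(K)` killed by `3`
are equal or opposite — `#W(K)[3] ≤ 3` — (and `W(K)[3] ≠ 0` iff cube-sum type, p558062).
[cite: SilvermanAEC2009, Exercise 3.7] [cite: Marcus1977, Ch. 2 (quadratic fields)] -/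
theorem threeTorsion_frameField_eq_or_eq_neg (hK2 : Module.finrank ℚ K = 2)
    (hdK : NumberField.discr K = -3) {W : WeierstrassCurve ℚ} {C : VariableChange ℚ} {k : ℚ}
    (hW : C • W = mordellCurve k) (hcube : ¬ ∃ c : ℚ, c ^ 3 = 4 * k)
    {P Q : (W.baseChange K).toAffine.Point} (hP : (3 : ℕ) • P = 0) (hQ : (3 : ℕ) • Q = 0)
    (hP0 : P ≠ 0) (hQ0 : Q ≠ 0) : P = Q ∨ P = -Q := by
  obtain ⟨θ, hθ, hF⟩ := exists_generator_frameField hK2 hdK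
  have hcube' : ¬ ∃ c : ℚ, c ^ 3 = -4 * k := fun h => hcube ((exists_cube_neg_iff k).mp h)
  -- transport along the model isomorphism over `K`
  have hmodel : (mordellCurve k).baseChange K = (C.map (algebraMap ℚ K)) • W.baseChange K := by
    rw [← hW, baseChange, baseChange, map_variableChange]
  have hmk : (mordellCurve k).baseChange K = mordellCurve (k : K) := by
    rw [mordellCurve_baseChange]; rfl
  let e : (W.baseChange K).toAffine.Point ≃+ (mordellCurve (k : K)).toAffine.Point :=
    (VariableChange.pointEquiv (W.baseChange K) (C.map (algebraMap ℚ K))).trans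
      (hmk ▸ hmodel ▸ AddEquiv.refl _)
  have h3e : ∀ {R : (W.baseChange K).toAffine.Point}, (3 : ℕ) • R = 0 → (3 : ℕ) • e R = 0 :=
    fun hR => by rw [← map_nsmul, hR, map_zero]
  have h0e : ∀ {R : (W.baseChange K).toAffine.Point}, R ≠ 0 → e R ≠ 0 :=
    fun hR h => hR (by simpa using congrArg e.symm h)
  rcases three_torsion_eq_or_eq_neg hθ hF hcube' (h3e hP) (h3e hQ) (h0e hP0) (h0e hQ0) with h | h
  · exact Or.inl (e.injective h)
  · exact Or.inr (e.injective (by rw [h, map_neg]))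

end Frame

end Summit.BirchSwinnertonDyer.BirchSwinnertonDyer.Theorems.PrintCFram.GlobalDefect

end
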